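import Summits.BirchSwinnertonDyer.BirchSwinnertonDyer.Theses.PAdicOrderV2
import Literature.NumberTheory.EllipticCurves.CanonicalPAdicHeight
import Literature.NumberTheory.EllipticCurves.Selmer
import Literature.NumberTheory.EllipticCurves.BSDSelmer

/-!
# Sketch — crux-ideate round 2, ideator k=4, crux stmt-BirchSwinnertonDyer-0487 (`PAdicOrderThesisR2`)

First lemmas (signatures over existing declarations; the easy logical glue is proved) for the two
crux idea cards of this seat:

* **Idea A `wieferich-jet`** (rank-one sector of X = `stub_UB_pos` on `{r_an = 1}`, non-CM):
  the canonical `p`-adic sigma function enters the cyclotomic height only beyond its universal,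
  `E₂`-free jet `σ_p(t) ≡ t + (a₁/2)t² (mod t³ ℤ_p)`; hence for an admissible point `P = (x, y)`,
  `den x = d²`, `e = v_p(d)`, the Stein–Wuthrich canonical height
  `ĥ_p(P) = log_p(den x) − 2 log_p σ_p(−x/y)` satisfies the JET CONGRUENCE
  `ĥ_p(P) ≡ log_p(num x) (mod p^{2e})` (`JetCongruence`; the a₁-term and `b` drop out because
  `b² + a₁abd ≡ a³ (mod d²)`). So `ĥ_p(P) = 0` forces the Wieferich congruence
  `a^{p−1} ≡ 1 (mod p^{2e})`, `a = num x`, on INTEGER data, and weak Schneider at one prime follows from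
  one non-"height-Wieferich" prime (`weakSchneiderAtOnePrime_of_jet`).
* **Idea B `heegner-coboundary`** (rank ≥ 2 sector; worked but NOT filed as a card — it reduces to
  summit cards heegner-generators-silent-rank-one / derived-class-capitulation-barrier and to route
  SelmerRank's thesis, see NOTES.md §dropped): the algebraic core of
  "the rank-two point is the trace of a `(σ_ℓ − 1)`-primitive of the Heegner point of Kolyvagin
  conductor `ℓ`": if `σ z − z = y` and `σⁿ = 1` then `n • z = N z + D y`
  (`N = Σ σ^i`, `D = Σ i σ^i`, Kolyvagin's derivative) — `KolyvaginTraceIdentity`; and the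
  Selmer-shadow lemma `two_le_selmerCorank_of_facts` (the KNOWN lower bound `s_p ≥ 2` in analytic
  rank 2 from a corank-positivity fact + `p`-parity), which is the α-input of the card.

Nothing here asserts a Theses decl; no `sorry`.
-/

set_option linter.dupNamespace false

namespace Summit.BirchSwinnertonDyer.BirchSwinnertonDyer.Cruxes.PAdicOrderThesisR2.Round2K4

open Literature.NumberTheory.EllipticCurves WeierstrassCurve

/-! ## Idea A — `wieferich-jet` -/

section IdeaA

/-- **First lemma A1 (JET CONGRUENCE).** For `W` globally minimal, `p ≥ 5` good ordinary and an
admissible point `P = (x, y)` (so `P ∈ E₁(ℚ_p)`, `v_p(den x) = 2e ≥ 2`), the canonical cyclotomic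
`p`-adic height (Stein–Wuthrich normalisation, `ĥ_p = log_p(den x) − 2 log_p σ_p(−x/y)`) is congruent
to the Iwasawa logarithm of the NUMERATOR of `x`:
`‖ĥ_p(P) − log_p(num x)‖ ≤ p^{-v_p(den x)}`, i.e. `ĥ_p(P) ≡ log_p a (mod p^{2e})` for `x = a/d²`.
Proof sketch (size M, from MST 2006 Thm 1.3 / Alg. 3.1 as vendored in `padicSigma`): `σ_p(t) ≡ z(t)
(mod z³ℤ_p)`, `z(t) ≡ t + (a₁/2)t² (mod t³)`, so `u := σ_p(t_P)/d ≡ w := −(a/b)(1 − a₁ad/(2b))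
(mod p^{2e})`; the Weierstrass equation gives `b² + a₁abd ≡ a³ (mod d²)`, whence `w² ≡ a⁻¹
(mod p^{2e})` on EVERY model, and `ĥ_p = −2 log_p u ≡ −log_p w² ≡ log_p a`. Hand check on MST 2006
§4.1 (37a1, `p = 5`, `Q = 8P = (21/25, −69/125)`): `ĥ₅(Q) = −10·(3 + 5 + ⋯) ≡ 20 ≡ log₅ 21 (mod 25)` ✓. -/
def JetCongruence : Prop :=
  ∀ (W : WeierstrassCurve ℚ) [W.IsElliptic] [W.IsGloballyMinimal] (p : ℕ) [Fact p.Prime],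
    5 ≤ p → IsOrdinaryAt W p →
    ∀ {x y : ℚ} (h : W.toAffine.Nonsingular x y), W.IsAdmissible p (.some x y h) →
      ‖W.canonicalPAdicHeight p (.some x y h) - padicLog p ((x.num : ℚ) : ℚ_[p])‖
        ≤ (p : ℝ) ^ (-(padicValNat p x.den : ℤ))

/-- **Height-Wieferich** at `(P = (x, y), p)`, elementary form: `p` is a Wieferich prime to base
`a = num x` AT LEVEL `2e = v_p(den x)`: `a^{p-1} ≡ 1 (mod p^{v_p(den x)})` (or the degenerate
`a = ±1`). For `e = 1`: the ordinary Wieferich condition `a^{p-1} ≡ 1 (mod p²)`, i.e. `q_p(a) ≡ 0`.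
This is what `ĥ_p(P) = 0` forces, by `JetCongruence`. -/
def IsHeightWieferich (p : ℕ) (x : ℚ) : Prop :=
  x.num ^ (p - 1) = 1 ∨ (padicValNat p x.den : ℤ) ≤ padicValInt p (x.num ^ (p - 1) - 1)

/-- The same in the normed form used by the glue (equivalent to `¬ IsHeightWieferich` by the
valuation of the Iwasawa logarithm on units, `‖log_p a‖ = ‖a^{p-1} − 1‖` for `p` odd, Iwasawa 1972
§4.4 — the line's second stub). -/
def IsJetVisible (p : ℕ) [Fact p.Prime] (x : ℚ) : Prop :=
  (p : ℝ) ^ (-(padicValNat p x.den : ℤ)) < ‖padicLog p ((x.num : ℚ) : ℚ_[p])‖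

/-- **(NW) — the transferred statement (elementary Diophantine form).** Every non-torsion
rational point has, at SOME good ordinary prime `p ≥ 5`, an admissible multiple `mP = (a/d², b/d³)`
with `a^{p-1} ≢ 1 (mod p^{v_p(d²)})`. (Heuristic failure probability `∼ p^{-(2e_p - 1)}` per prime,
independent in `p`; expected number of failing primes `≤ X` is `∼ log log X`, of ALL failing: 0.) -/
def HeightNonWieferich : Prop :=
  ∀ (W : WeierstrassCurve ℚ) [W.IsElliptic] [W.IsGloballyMinimal] (P : W.toAffine.Point),
    ¬ IsOfFinAddOrder P →
    ∃ (p : ℕ) (_ : Fact p.Prime), 5 ≤ p ∧ IsOrdinaryAt W p ∧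
      ∃ (m : ℕ) (x y : ℚ) (h : W.toAffine.Nonsingular x y), m • P = .some x y h ∧
        W.IsAdmissible p (.some x y h) ∧ ¬ IsHeightWieferich p x

/-- (NW) in the normed form. -/
def JetVisibleSomewhere : Prop :=
  ∀ (W : WeierstrassCurve ℚ) [W.IsElliptic] [W.IsGloballyMinimal] (P : W.toAffine.Point),
    ¬ IsOfFinAddOrder P →
    ∃ (p : ℕ) (_ : Fact p.Prime), 5 ≤ p ∧ IsOrdinaryAt W p ∧
      ∃ (m : ℕ) (x y : ℚ) (h : W.toAffine.Nonsingular x y), m • P = .some x y h ∧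
        W.IsAdmissible p (.some x y h) ∧ IsJetVisible p x

/-- **Weak Schneider at ONE prime** (the open input of `stub_UB_pos` in analytic rank one for
non-CM curves; `PAdicHeightBarrierNarrow` scope (d)): every non-torsion point has a good ordinary
`p ≥ 5` and an admissible multiple of non-zero canonical cyclotomic `p`-adic height (hence
`ĥ_p(P) ≠ 0` by `ĥ_p(mP) = m² ĥ_p(P)`). -/
def WeakSchneiderAtOnePrime : Prop :=
  ∀ (W : WeierstrassCurve ℚ) [W.IsElliptic] [W.IsGloballyMinimal] (P : W.toAffine.Point),
    ¬ IsOfFinAddOrder P →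
    ∃ (p : ℕ) (_ : Fact p.Prime), 5 ≤ p ∧ IsOrdinaryAt W p ∧
      ∃ (m : ℕ) (x y : ℚ) (h : W.toAffine.Nonsingular x y), m • P = .some x y h ∧
        W.IsAdmissible p (.some x y h) ∧ W.canonicalPAdicHeight p (.some x y h) ≠ 0

/-- The one-point certificate: jet congruence + jet visibility ⇒ `ĥ_p(P) ≠ 0`. -/
theorem canonicalPAdicHeight_ne_zero_of_jet {W : WeierstrassCurve ℚ} {p : ℕ} [Fact p.Prime]
    {x y : ℚ} (h : W.toAffine.Nonsingular x y)
    (hJ : ‖W.canonicalPAdicHeight p (.some x y h) - padicLog p ((x.num : ℚ) : ℚ_[p])‖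
        ≤ (p : ℝ) ^ (-(padicValNat p x.den : ℤ)))
    (hvis : IsJetVisible p x) :
    W.canonicalPAdicHeight p (.some x y h) ≠ 0 := by
  intro h0
  rw [h0, zero_sub, norm_neg] at hJ
  exact absurd hvis (not_lt.mpr hJ)

/-- **Glue A (proved): (NW, normed form) + jet congruence ⇒ weak Schneider at one prime.** -/
theorem weakSchneiderAtOnePrime_of_jet (hJ : JetCongruence) (hNW : JetVisibleSomewhere) :
    WeakSchneiderAtOnePrime := by
  unfold WeakSchneiderAtOnePrime
  intro W _ _ P hP
  obtain ⟨p, hp, h5, hord, m, x, y, h, hmP, hadm, hvis⟩ := hNW W P hP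
  exact ⟨p, hp, h5, hord, m, x, y, h, hmP, hadm,
    canonicalPAdicHeight_ne_zero_of_jet h (hJ W p h5 hord h hadm) hvis⟩

end IdeaA

/-! ## Idea B — `heegner-coboundary` (worked, not filed; kept for the record) -/

section IdeaB

/-- **First lemma B1 (Kolyvagin trace identity), abstract form.** In an additive group with an
endomorphism `σ` of order dividing `n`: if `σ z − z = y` then
`n • z = Σ_{i<n} σ^i z + Σ_{i<n} i • σ^i y` — i.e. `z = (N z + D y)/n` with `N` the norm and
`D = Σ i σ^i` Kolyvagin's derivative operator (`(σ − 1) D = n − N`). Applied to `y = y_ℓ`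
(Heegner point of Kolyvagin conductor `ℓ`, `n = ℓ + 1`, `σ` a generator of `Gal(K_ℓ/K)`):
the `K`-rational point `P := N z` satisfies `D_ℓ y_ℓ ≡ −P + n • z`, Kolyvagin's congruence. -/
def KolyvaginTraceIdentity : Prop :=
  ∀ {A : Type} [AddCommGroup A] (σ : A →+ A) (n : ℕ), (⇑σ)^[n] = id →
    ∀ (y z : A), σ z - z = y →
      (n : ℤ) • z = (∑ i ∈ Finset.range n, (⇑σ)^[i] z) + ∑ i ∈ Finset.range n, (i : ℤ) • (⇑σ)^[i] y

/-- Positivity of the Selmer corank in positive analytic rank at a good ordinary prime with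
irreducible residual representation (Skinner–Urban 2006 ICM Thm; today a consequence of the IMC
equality + interpolation `L_p(E,0) = (1 − α⁻¹)² L(E,1)/Ω = 0` + Mazur control). Stated as the
hypothesis it is (a named input, not asserted). -/
def SelmerCorankPosOfAnalyticRankPos : Prop :=
  ∀ (W : WeierstrassCurve ℚ) [W.IsElliptic] [W.IsGloballyMinimal] (p : ℕ) [Fact p.Prime],
    5 ≤ p → IsOrdinaryAt W p → W.HasSurjectiveModNGaloisRep p →
      0 < W.analyticRank → 0 < W.selmerCorank p

/-- **Glue B (proved): the Selmer-shadow lower bound in analytic rank 2** — `s_p ≥ 2` from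
corank-positivity and `p`-parity (`selmerCorank_mod_two_eq`, Dokchitser–Dokchitser / Nekovář).
This is the KNOWN α-input of the card (`r_an ≤ s_p` for `r_an = 2`). -/
theorem two_le_selmerCorank_of_facts (hpos : SelmerCorankPosOfAnalyticRankPos)
    (hpar : ∀ (W : WeierstrassCurve ℚ) [W.IsElliptic] (p : ℕ) [Fact p.Prime],
      selmerCorank_mod_two_eq W p)
    (W : WeierstrassCurve ℚ) [W.IsElliptic] [W.IsGloballyMinimal] (p : ℕ) [Fact p.Prime]
    (h5 : 5 ≤ p) (hord : IsOrdinaryAt W p) (hsurj : W.HasSurjectiveModNGaloisRep p)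
    (h2 : W.analyticRank = 2) : 2 ≤ W.selmerCorank p := by
  have hpos' : 0 < W.selmerCorank p := hpos W p h5 hord hsurj (by omega)
  have hpar' := hpar W p
  unfold selmerCorank_mod_two_eq at hpar'
  rw [h2] at hpar'
  omega

end IdeaB

end Summit.BirchSwinnertonDyer.BirchSwinnertonDyer.Cruxes.PAdicOrderThesisR2.Round2K4
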